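import Mathlib
import HarnessLib
import Summits.ResolutionOfSingularities.ResolutionOfSingularities.Theorems.WildQuotientsWildQuotientResolutionZ9PeeledTwistedLiftCube
import Summits.ResolutionOfSingularities.ResolutionOfSingularities.Theorems.WildQuotientsWildQuotientResolutionFixedPointsRegular
import Literature.AlgebraicGeometry.Resolution.FiniteQuotientSingularityPresentation

/-!
# ℤ9 SPECIMEN (peeled `𝔸⁴/ℤ9`, char 3), brick Z4T part 2: Király–Lütkebohmert on the TWISTED `μ₄`
# ROOT CHART — the augmentation ideal of `σ̃` is locally principal, so `L^{σ̃}` is a regular ring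
(crux stmt-ResolutionOfSingularities-15640 `WildQuotients.WildQuotientResolution`, line `Sketch`; S1 =
stmt-ResolutionOfSingularities-17941 `CyclicQuotientFourfolds`; chain w45c card-P specimen «peeled 𝔸⁴/ℤ9»,
variant V-BR, brick Z4T (res-L1-w45c-idea-2 `Z4T-TWIST.md` 75f51c076580e517 §2 «the AUGMENTATION IDEAL
on T», CHAIN v9.3 §4 «Z4T = stub-2», res-L1-w45c-stub-2 SIG 17:39:44Z). [OURS · L1 W4.5c] — NOT a
statement of any manuscript; replaces the role of no printed item; AI-produced, kernel-checked ≠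
expert-reviewed. Def-free, LAW-BASED over the laws of `…Z9PeeledTwistedLift`.)

For ANY `k`-algebra automorphism `σ̃` of `L = k[x][u⁻¹]` with the twisted-lift laws
(`…Z9PeeledTwistedLift`; one exists with `σ̃³ = 1` by `exists_twistedLift`):

* `lift_apply_J` — `σ̃ (u⁻¹) = v³·u⁻¹`;
* `S_cube_dvd_twistedLift_sub` — **`S³ ∣ σ̃ y − y` for every `y ∈ L`** (generators: `σ̃S − S = S⁴α`,
  `σ̃α − α = −S³α²·iv·(iv³+iv²+iv+1)`, `σ̃γ − γ = S³(v' − αγ·iv)`, `σ̃w − w = S³(γ³ − S¹²α²u²γ)`,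
  `σ̃(u⁻¹) − u⁻¹ = S³·α u⁻¹(v²+v+1)`; then `k[x]` by induction and `L` by `y = ι r · u⁻ᵐ`);
* `twistedLift_theta_not_mem` — at a prime `𝔮 ∋ S` one of `θ_γ = v' − αγ·iv`, `θ_w = γ³ − S¹²α²u²γ`
  is NOT in `𝔮` (the certificate `(1 − αγ)(1 + αγ + α²γ²) + α³γ³ = 1` of the memo: modulo `(S) + 𝔮`,
  `γ³ ∈ 𝔮 ⇒ γ ∈ 𝔮 ⇒ 1 − αγ ≡ 1`);
* **`twistedLift_map_augIdeal_isPrincipal`** — at EVERY prime `𝔮` of `L` the image of the augmentation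
  ideal `⟨σ̃y − y⟩` in `L_𝔮` is principal: `= (S³)` if `S ∈ 𝔮`, `= ⊤` if `S ∉ 𝔮` (because
  `σ̃(Sγ) − Sγ = S⁴u` with `u` a unit — off `E = {S = 0}` the action is free);
* **`twistedLift_fixedPoints_isRegularRing`** — `L^{σ̃} = FixedPoints.subalgebra k L (zpowers σ̃)` is a
  REGULAR ring (tree K–L `isRegularRing_fixedPoints_zpowers`, p = 3; `L` is a regular domain of finite
  type over `k` as a localisation of `k[x]`). With the commuting `μ₄` (weights `(1,1,3,0)` on
  `(S,α,γ,w)`) this is the smooth graded algebra of the V-BR chart datum of the piece `P_T` — the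
  grading and the seam `Γ(P_T) ≅ L₀` are part 3.
-/

-- single-problem summit: the doubled namespace component `ResolutionOfSingularities` is forced
set_option linter.dupNamespace false

noncomputable section

open MvPolynomial

namespace Summit.ResolutionOfSingularities.ResolutionOfSingularities.Theorems.WildQuotientResolution.Z9Peeled

variable (k : Type) [Field k] (n : ℕ) (a b c d : Fin n)

/-- `u = 1 − S⁶α²` (local shorthand; slots `S = X b`, `α = X a`). -/
local notation3 "uT" => (1 - X b ^ 6 * X a ^ 2 : MvPolynomial (Fin n) k)
/-- `v = 1 + S³α` (local shorthand). -/
local notation3 "vT" => (1 + X b ^ 3 * X a : MvPolynomial (Fin n) k)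
/-- `v' = 1 − S³α` (local shorthand). -/
local notation3 "vT'" => (1 - X b ^ 3 * X a : MvPolynomial (Fin n) k)
/-- The twisted root chart ring `L = k[x][u⁻¹]` (local shorthand). -/
local notation3 "LT" => Localization.Away (1 - X b ^ 6 * X a ^ 2 : MvPolynomial (Fin n) k)
/-- `ι : k[x] → L` (local shorthand). -/
local notation3 "ιT" => algebraMap (MvPolynomial (Fin n) k)
  (Localization.Away (1 - X b ^ 6 * X a ^ 2 : MvPolynomial (Fin n) k))
/-- `J = u⁻¹ ∈ L` (local shorthand). -/
local notation3 "JT" => (IsLocalization.Away.invSelf (1 - X b ^ 6 * X a ^ 2 : MvPolynomial (Fin n) k) :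
  Localization.Away (1 - X b ^ 6 * X a ^ 2 : MvPolynomial (Fin n) k))
/-- `iv = (ι v)⁻¹ = ι v'·J` (local shorthand). -/
local notation3 "ivT" => (algebraMap (MvPolynomial (Fin n) k)
  (Localization.Away (1 - X b ^ 6 * X a ^ 2 : MvPolynomial (Fin n) k)) (1 - X b ^ 3 * X a) *
    (IsLocalization.Away.invSelf (1 - X b ^ 6 * X a ^ 2 : MvPolynomial (Fin n) k) :
      Localization.Away (1 - X b ^ 6 * X a ^ 2 : MvPolynomial (Fin n) k)))

/-- `u ≠ 0` in `k[x]`. [folklore] -/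
theorem u_ne_zero : uT ≠ 0 := by
  classical
  intro h
  have h' := congrArg MvPolynomial.constantCoeff h
  simp [MvPolynomial.constantCoeff_X] at h'

/-- `ι : k[x] → L` is injective. [folklore] -/
theorem algebraMap_L_injective : Function.Injective ιT :=
  IsLocalization.injective (Localization.Away (1 - X b ^ 6 * X a ^ 2 : MvPolynomial (Fin n) k))
    (powers_le_nonZeroDivisors_of_noZeroDivisors (u_ne_zero k n a b))

/-- `σ̃ (u⁻¹) = v³·u⁻¹` (char 3). [OURS · L1 W4.5c] -/
theorem lift_apply_J [CharP k 3] (τ : LT →ₐ[k] LT)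
    (hS : τ (ιT (X b)) = ιT (X b * vT)) (hA : τ (ιT (X a)) = ιT (X a) * ivT ^ 4) :
    τ JT = ιT vT ^ 3 * JT := by
  have hJ := algebraMap_v_mul_iv k n a b
  have h1 := algebraMap_u_mul_J k n a b
  have e : τ (ιT uT) * τ JT = 1 := by rw [← map_mul, h1, map_one]
  rw [lift_apply_u k n a b τ hS hA] at e
  linear_combination (-(τ JT) * ((ιT vT * ivT) ^ 2 + ιT vT * ivT + 1)) * hJ + (ιT vT ^ 3 * JT) * e

-- induction over `k[x]` plus the localisation bookkeeping; head-room
set_option maxHeartbeats 1600000 in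
/-- **`S³ ∣ σ̃ y − y` for every `y ∈ L`** (char 3; see the module docstring for the generators).
[OURS · L1 W4.5c] -/
theorem S_cube_dvd_twistedLift_sub [CharP k 3] (τ : LT →ₐ[k] LT)
    (hS : τ (ιT (X b)) = ιT (X b * vT)) (hA : τ (ιT (X a)) = ιT (X a) * ivT ^ 4)
    (hG : τ (ιT (X c)) = ιT (X c) * ivT + ιT (X b ^ 3 * vT'))
    (hW : τ (ιT (X d)) = ιT (X d + X b ^ 3 * X c ^ 3 - X b ^ 15 * X a ^ 2 * uT ^ 2 * X c))
    (hfix : ∀ i, i ≠ a → i ≠ b → i ≠ c → i ≠ d → τ (ιT (X i)) = ιT (X i)) (y : LT) :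
    ιT (X b) ^ 3 ∣ τ y - y := by
  classical
  have hJ := algebraMap_v_mul_iv k n a b
  have hV := algebraMap_v_eq k n a b
  have h1 := algebraMap_u_mul_J k n a b
  -- generators
  have dS : ιT (X b) ^ 3 ∣ τ (ιT (X b)) - ιT (X b) := by
    refine ⟨ιT (X b) * ιT (X a), ?_⟩
    rw [hS, map_mul, hV]; ring
  have dA : ιT (X b) ^ 3 ∣ τ (ιT (X a)) - ιT (X a) := by
    refine ⟨-(ιT (X a) ^ 2 * ivT * (ivT ^ 3 + ivT ^ 2 + ivT + 1)), ?_⟩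
    rw [hA]
    linear_combination (ιT (X a) * (ivT ^ 3 + ivT ^ 2 + ivT + 1)) * hJ -
      (ιT (X a) * (ivT ^ 3 + ivT ^ 2 + ivT + 1) * ivT) * hV
  have dG : ιT (X b) ^ 3 ∣ τ (ιT (X c)) - ιT (X c) := by
    refine ⟨ιT vT' - ιT (X a) * ιT (X c) * ivT, ?_⟩
    rw [hG, map_mul, map_pow]
    linear_combination (ιT (X c)) * hJ - (ιT (X c) * ivT) * hV
  have dW : ιT (X b) ^ 3 ∣ τ (ιT (X d)) - ιT (X d) := by
    refine ⟨ιT (X c) ^ 3 - ιT (X b) ^ 12 * ιT (X a) ^ 2 * ιT uT ^ 2 * ιT (X c), ?_⟩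
    rw [hW, map_sub (algebraMap _ _), map_add (algebraMap _ _)]
    simp only [map_mul, map_pow]
    ring
  have dJ : ιT (X b) ^ 3 ∣ τ JT - JT := by
    refine ⟨ιT (X a) * JT * (ιT vT ^ 2 + ιT vT + 1), ?_⟩
    rw [lift_apply_J k n a b τ hS hA]
    linear_combination (JT * (ιT vT ^ 2 + ιT vT + 1)) * hV
  -- all variables
  have dX : ∀ i : Fin n, ιT (X b) ^ 3 ∣ τ (ιT (X i)) - ιT (X i) := by
    intro i
    by_cases hia : i = a
    · rw [hia]; exact dA
    by_cases hib : i = b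
    · rw [hib]; exact dS
    by_cases hic : i = c
    · rw [hic]; exact dG
    by_cases hid : i = d
    · rw [hid]; exact dW
    · rw [hfix i hia hib hic hid, sub_self]; exact dvd_zero _
  -- `k[x]`
  have dP : ∀ r : MvPolynomial (Fin n) k, ιT (X b) ^ 3 ∣ τ (ιT r) - ιT r := by
    intro r
    induction r using MvPolynomial.induction_on with
    | C r =>
      have h : ιT (C r) = algebraMap k LT r := by
        rw [← MvPolynomial.algebraMap_eq]
        exact (IsScalarTower.algebraMap_apply k (MvPolynomial (Fin n) k) LT r).symm
      rw [h, AlgHom.commutes, sub_self]; exact dvd_zero _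
    | add p q hp hq =>
      have e : τ (ιT (p + q)) - ιT (p + q) = (τ (ιT p) - ιT p) + (τ (ιT q) - ιT q) := by
        rw [map_add (algebraMap (MvPolynomial (Fin n) k) LT), map_add τ]; ring
      rw [e]; exact dvd_add hp hq
    | mul_X p i hp =>
      have e : τ (ιT (p * X i)) - ιT (p * X i) =
          τ (ιT p) * (τ (ιT (X i)) - ιT (X i)) + (τ (ιT p) - ιT p) * ιT (X i) := by
        rw [map_mul (algebraMap (MvPolynomial (Fin n) k) LT), map_mul τ]; ring
      rw [e]; exact dvd_add (dvd_mul_of_dvd_right (dX i) _) (dvd_mul_of_dvd_left hp _)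
  -- `L`: `y = ι r · J ^ m`
  obtain ⟨⟨r, ⟨s, ⟨m, rfl⟩⟩⟩, hy⟩ := IsLocalization.surj (Submonoid.powers uT) y
  have hy' : y = ιT r * JT ^ m := by
    have e : y = y * (ιT uT * JT) ^ m := by rw [h1, one_pow, mul_one]
    rw [e, mul_pow, ← mul_assoc, ← map_pow]
    exact congrArg (· * JT ^ m) hy
  have e : τ y - y = (τ (ιT r) - ιT r) * τ JT ^ m + ιT r * (τ JT ^ m - JT ^ m) := by
    rw [hy', map_mul τ, map_pow τ]; ring
  rw [e]
  exact dvd_add (dvd_mul_of_dvd_left (dP r) _)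
    (dvd_mul_of_dvd_right (dvd_trans dJ (sub_dvd_pow_sub_pow _ _ m)) _)

/-- `σ̃(Sγ) − Sγ = S⁴u`: off `E = {S = 0}` the augmentation ideal is the unit ideal. [OURS · L1 W4.5c] -/
theorem twistedLift_sub_Sγ (τ : LT →ₐ[k] LT)
    (hS : τ (ιT (X b)) = ιT (X b * vT)) (hG : τ (ιT (X c)) = ιT (X c) * ivT + ιT (X b ^ 3 * vT')) :
    τ (ιT (X b * X c)) - ιT (X b * X c) = ιT (X b) ^ 4 * ιT uT := by
  rw [lift_twist_X_c k n a b c τ hS hG, map_add, map_mul (algebraMap _ _) (X b ^ 4), map_pow]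
  ring

/-- **At a prime `𝔮 ∋ S`, one of `θ_γ = v' − αγ·iv`, `θ_w = γ³ − S¹²α²u²γ` is not in `𝔮`**
(`σ̃γ − γ = S³θ_γ`, `σ̃w − w = S³θ_w`; the certificate `(1 − αγ)(1 + αγ + α²γ²) + (αγ)³ = 1`).
[OURS · L1 W4.5c] -/
theorem twistedLift_theta_not_mem (𝔮 : Ideal LT) [𝔮.IsPrime] (hSq : ιT (X b) ∈ 𝔮) :
    ιT vT' - ιT (X a) * ιT (X c) * ivT ∉ 𝔮 ∨
      ιT (X c) ^ 3 - ιT (X b) ^ 12 * ιT (X a) ^ 2 * ιT uT ^ 2 * ιT (X c) ∉ 𝔮 := by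
  by_cases hγq : ιT vT' - ιT (X a) * ιT (X c) * ivT ∈ 𝔮
  swap
  · exact Or.inl hγq
  by_cases hwq : ιT (X c) ^ 3 - ιT (X b) ^ 12 * ιT (X a) ^ 2 * ιT uT ^ 2 * ιT (X c) ∈ 𝔮
  swap
  · exact Or.inr hwq
  exfalso
  have hJ := algebraMap_v_mul_iv k n a b
  have hV := algebraMap_v_eq k n a b
  have hV' := algebraMap_v'_eq k n a b
  -- `γ³ ∈ 𝔮`, hence `γ ∈ 𝔮`
  have hγ3 : ιT (X c) ^ 3 ∈ 𝔮 := by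
    have : ιT (X c) ^ 3 = (ιT (X c) ^ 3 - ιT (X b) ^ 12 * ιT (X a) ^ 2 * ιT uT ^ 2 * ιT (X c)) +
        ιT (X b) * (ιT (X b) ^ 11 * ιT (X a) ^ 2 * ιT uT ^ 2 * ιT (X c)) := by ring
    rw [this]
    exact 𝔮.add_mem hwq (𝔮.mul_mem_right _ hSq)
  have hγ : ιT (X c) ∈ 𝔮 := Ideal.IsPrime.mem_of_pow_mem ‹_› 3 hγ3
  -- `iv ≡ 1`, `v' ≡ 1` modulo `(S)`: `1 = θ_γ + αγ·iv + S³α ∈ 𝔮`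
  have h1 : (1 : LT) = (ιT vT' - ιT (X a) * ιT (X c) * ivT) + ιT (X c) * (ιT (X a) * ivT) +
      ιT (X b) * (ιT (X b) ^ 2 * ιT (X a)) := by
    rw [hV']; ring
  have hone : (1 : LT) ∈ 𝔮 := by
    rw [h1]
    exact 𝔮.add_mem (𝔮.add_mem hγq (𝔮.mul_mem_right _ hγ)) (𝔮.mul_mem_right _ hSq)
  exact (Ideal.IsPrime.ne_top ‹_›) ((Ideal.eq_top_iff_one _).mpr hone)

-- the case analysis at a prime runs over the long law binders; head-room
set_option maxHeartbeats 800000 in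
/-- **At every prime `𝔮` of `L`, the image of the augmentation ideal `⟨σ̃y − y : y⟩` in `L_𝔮` is
principal** (`= (S³)` if `S ∈ 𝔮`, `= ⊤` if `S ∉ 𝔮`); in particular the hypothesis `hdiv` of the tree's
K–L theorem `isRegularRing_fixedPoints_zpowers` holds (even without assuming `𝔮` fixed).
[OURS · L1 W4.5c] -/
theorem twistedLift_map_augIdeal_isPrincipal [CharP k 3] (σt : LT ≃ₐ[k] LT)
    (hS : σt (ιT (X b)) = ιT (X b * vT)) (hA : σt (ιT (X a)) = ιT (X a) * ivT ^ 4)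
    (hG : σt (ιT (X c)) = ιT (X c) * ivT + ιT (X b ^ 3 * vT'))
    (hW : σt (ιT (X d)) = ιT (X d + X b ^ 3 * X c ^ 3 - X b ^ 15 * X a ^ 2 * uT ^ 2 * X c))
    (hfix : ∀ i, i ≠ a → i ≠ b → i ≠ c → i ≠ d → σt (ιT (X i)) = ιT (X i))
    (𝔮 : Ideal LT) [𝔮.IsPrime] :
    ((Ideal.span (Set.range fun y : LT => σt y - y)).map
      (algebraMap LT (Localization.AtPrime 𝔮))).IsPrincipal := by
  classical
  let τ : LT →ₐ[k] LT := σt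
  have hτ : ∀ y, τ y = σt y := fun _ => rfl
  have hJ := algebraMap_v_mul_iv k n a b
  have hV := algebraMap_v_eq k n a b
  have hV' := algebraMap_v'_eq k n a b
  have h1 := algebraMap_u_mul_J k n a b
  set I : Ideal LT := Ideal.span (Set.range fun y : LT => σt y - y) with hI
  let φ := algebraMap LT (Localization.AtPrime 𝔮)
  have hmemI : ∀ y, σt y - y ∈ I := fun y => Ideal.subset_span ⟨y, rfl⟩
  by_cases hSq : ιT (X b) ∈ 𝔮
  · -- `S ∈ 𝔮`: the image is `(S³)`
    -- one of the `θ`'s is a unit at `𝔮`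
    have hθ := twistedLift_theta_not_mem k n a b c 𝔮 hSq
    -- `S³ θ_γ = σ̃ γ − γ ∈ I`, `S³ θ_w = σ̃ w − w ∈ I`
    have hγI : ιT (X b) ^ 3 * (ιT vT' - ιT (X a) * ιT (X c) * ivT) ∈ I := by
      have e : σt (ιT (X c)) - ιT (X c) = ιT (X b) ^ 3 * (ιT vT' - ιT (X a) * ιT (X c) * ivT) := by
        rw [hG, map_mul, map_pow]
        linear_combination (ιT (X c)) * hJ - (ιT (X c) * ivT) * hV
      rw [← e]; exact hmemI _
    have hwI : ιT (X b) ^ 3 * (ιT (X c) ^ 3 - ιT (X b) ^ 12 * ιT (X a) ^ 2 * ιT uT ^ 2 * ιT (X c)) ∈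
        I := by
      have e : σt (ιT (X d)) - ιT (X d) =
          ιT (X b) ^ 3 * (ιT (X c) ^ 3 - ιT (X b) ^ 12 * ιT (X a) ^ 2 * ιT uT ^ 2 * ιT (X c)) := by
        rw [hW, map_sub (algebraMap _ _), map_add (algebraMap _ _)]
        simp only [map_mul, map_pow]
        ring
      rw [← e]; exact hmemI _
    -- hence `φ (S³) ∈ I.map φ`
    have hS3 : φ (ιT (X b) ^ 3) ∈ I.map φ := by
      rcases hθ with hθ | hθ
      · have hu : IsUnit (φ (ιT vT' - ιT (X a) * ιT (X c) * ivT)) :=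
          (IsLocalization.AtPrime.isUnit_to_map_iff (Localization.AtPrime 𝔮) 𝔮 _).mpr hθ
        obtain ⟨w, hw⟩ := hu.exists_right_inv
        have hm := Ideal.mem_map_of_mem φ hγI
        rw [map_mul] at hm
        have := Ideal.mul_mem_right w _ hm
        rwa [mul_assoc, hw, mul_one] at this
      · have hu : IsUnit (φ (ιT (X c) ^ 3 - ιT (X b) ^ 12 * ιT (X a) ^ 2 * ιT uT ^ 2 * ιT (X c))) :=
          (IsLocalization.AtPrime.isUnit_to_map_iff (Localization.AtPrime 𝔮) 𝔮 _).mpr hθ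
        obtain ⟨w, hw⟩ := hu.exists_right_inv
        have hm := Ideal.mem_map_of_mem φ hwI
        rw [map_mul] at hm
        have := Ideal.mul_mem_right w _ hm
        rwa [mul_assoc, hw, mul_one] at this
    refine ⟨⟨φ (ιT (X b) ^ 3), le_antisymm ?_ ?_⟩⟩
    · -- `I.map φ ≤ (φ S³)`: every `σ̃ y − y` is a multiple of `S³`
      rw [Ideal.map_le_iff_le_comap, hI, Ideal.span_le]
      rintro _ ⟨y, rfl⟩
      obtain ⟨w, hw⟩ := S_cube_dvd_twistedLift_sub k n a b c d τ hS hA hG hW hfix y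
      show φ (σt y - y) ∈ Ideal.span {φ (ιT (X b) ^ 3)}
      rw [← hτ, hw, map_mul]
      exact Ideal.mul_mem_right _ _ (Ideal.mem_span_singleton_self _)
    · rw [Ideal.submodule_span_eq, Ideal.span_singleton_le_iff_mem]
      exact hS3
  · -- `S ∉ 𝔮`: the image is the unit ideal (`σ̃(Sγ) − Sγ = S⁴u ∈ I`)
    have hSγ : ιT (X b) ^ 4 * ιT uT ∈ I := by
      rw [← twistedLift_sub_Sγ k n a b c τ hS hG]; exact hmemI _
    have hunit : IsUnit (φ (ιT (X b) ^ 4 * ιT uT)) := by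
      refine (IsLocalization.AtPrime.isUnit_to_map_iff (Localization.AtPrime 𝔮) 𝔮 _).mpr ?_
      intro hmem
      rcases (Ideal.IsPrime.mem_or_mem ‹_› hmem) with h | h
      · exact hSq (Ideal.IsPrime.mem_of_pow_mem ‹_› 4 h)
      · have hu : IsUnit (ιT uT) := IsUnit.of_mul_eq_one JT h1
        exact (Ideal.IsPrime.ne_top ‹_›) (Ideal.eq_top_of_isUnit_mem _ h hu)
    have htop : I.map φ = ⊤ := Ideal.eq_top_of_isUnit_mem _ (Ideal.mem_map_of_mem φ hSγ) hunit
    rw [htop]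
    exact ⟨⟨1, by rw [Ideal.submodule_span_eq, Ideal.span_singleton_one]⟩⟩

/-- **K–L on the twisted root chart**: for the peeled `σ̄` (char 3) and ANY lift `σ̃ : L ≃ₐ[k] L` with
the twisted-lift laws and `σ̃ ^ 3 = 1` (one exists: `exists_twistedLift`), the invariant ring
`L^{σ̃} = FixedPoints.subalgebra k L (zpowers σ̃)` is REGULAR. [OURS · L1 W4.5c]
[cite: KiralyLutkebohmert2013, Thm 2 (via the tree's `isRegularRing_fixedPoints_zpowers`)] -/
theorem twistedLift_fixedPoints_isRegularRing [CharP k 3] (σt : LT ≃ₐ[k] LT)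
    (hS : σt (ιT (X b)) = ιT (X b * vT)) (hA : σt (ιT (X a)) = ιT (X a) * ivT ^ 4)
    (hG : σt (ιT (X c)) = ιT (X c) * ivT + ιT (X b ^ 3 * vT'))
    (hW : σt (ιT (X d)) = ιT (X d + X b ^ 3 * X c ^ 3 - X b ^ 15 * X a ^ 2 * uT ^ 2 * X c))
    (hfix : ∀ i, i ≠ a → i ≠ b → i ≠ c → i ≠ d → σt (ιT (X i)) = ιT (X i)) (hσt3 : σt ^ 3 = 1) :
    IsRegularRing (FixedPoints.subalgebra k LT (Subgroup.zpowers σt)) := by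
  classical
  haveI : IsDomain LT := IsLocalization.isDomain_of_le_nonZeroDivisors _
    (powers_le_nonZeroDivisors_of_noZeroDivisors (u_ne_zero k n a b))
  haveI : IsRegularRing LT :=
    Literature.AlgebraicGeometry.Resolution.isRegularRing_localization (Submonoid.powers uT)
  haveI : Algebra.FiniteType (MvPolynomial (Fin n) k) LT :=
    IsLocalization.finiteType_of_monoid_fg (Submonoid.powers uT) LT
  haveI : Algebra.FiniteType k LT := Algebra.FiniteType.trans (S := MvPolynomial (Fin n) k)
    inferInstance inferInstance
  exact TameTransfer.isRegularRing_fixedPoints_zpowers Nat.prime_three σt (twistedLift_ne_one k n a b σt hS) hσt3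
    (fun 𝔮 _ _ => twistedLift_map_augIdeal_isPrincipal k n a b c d σt hS hA hG hW hfix 𝔮)

end Summit.ResolutionOfSingularities.ResolutionOfSingularities.Theorems.WildQuotientResolution.Z9Peeled

end
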